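import Summits.QuantumFields.YangMills.Theses.UnitScaleTilt
import Summits.QuantumFields.YangMills.Theorems.UnitScaleTiltFluctuationComparisonRegPrIntLChiV3
import HarnessLib

/-
# SKELETON v5kC — crux `FluctuationComparisonRegPrIntL` (route `UnitScaleTilt`, item stmt-QuantumFields-20520, DECIDING) — OWNER PEN ym3-torus-plan g23 (RULING g23-№2 «R-57χ»
# + ADDENDA 2/5/6/7; record-only C3 move; binders/`closes` byte-unchanged).  = v5k-B (3b016214180ca501) with the R-57χ ONE-TOKEN successor stubs (ADD. 6:
# `AlphaInputsT3ACv3Rec ↦ …RecChi`, `OfV3At ↦ OfV3ChiAt`, `PkgAtV3 ↦ PkgAtV3Chi`, `dataOfV3 ↦ dataOfV3chi` — the (α) record re-typed with PRINT'S lower row (47) «χ·χ_k»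
# on `PinnedStep.loPrintAC`, after the field-slot row `Bound55AC.Fibre57LowAC` was refuted at row level #44/#45) and T ↦ T8 (ADD. 7: [Balaban1985Variational] Thm 1 ∧ its
# (8)-clause in ∀-form); STUB 1 verbatim (CLOSED in the tree by name, p490827).  §2 = ONE LINE through ★ym-ust-19935-r1 g3's record-free engine
# `InteriorExcision.regPrIntL_of_v3ChiStubs` (p570604 `Theorems/UnitScaleTiltFluctuationComparisonRegPrIntLChiV3.lean`; engine p550585/p554235; χ-record cone p547740 p549652
# p550225 p550637 p563497 p565022 p565451 p566734 p568228).  Pen base: r1 g3 draft `ym-ust-19935-r1/drafts-g3/birth_v5kC_r1draft.lean` 8604d4423b14506a (owner edits: this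
# header and STUB 1's cite locator per lit g21 L-48; statements byte-identical with the draft).
-/
noncomputable section

namespace Summit.QuantumFields.YangMills.Cruxes.FluctuationComparisonRegPrIntL.BirthV5kC

open MeasureTheory Filter Topology
open Literature.MathematicalPhysics.QuantumFieldTheory.Balaban1983to89
open Literature.MathematicalPhysics.QuantumFieldTheory.Balaban1983to89.T3ContinuumYM3Torus
open Literature.MathematicalPhysics.QuantumFieldTheory.Balaban1983to89.T3UnitLawDensityEML (ℰp measurableE_ℰp)
open Literature.MathematicalPhysics.QuantumFieldTheory.Balaban1983to89.T3UnitScaleTilt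
open Literature.MathematicalPhysics.QuantumFieldTheory.Balaban1983to89.T3SmallLiftHistory
open Literature.MathematicalPhysics.QuantumFieldTheory.Balaban1983to89.T3PrintedMinimiserExistence
open Literature.MathematicalPhysics.QuantumFieldTheory.Balaban1983to89.T3LowerAlongMinimisersSplit (MinimisersIn8At)
open Summit.QuantumFields.YangMills.Theorems.PrintChi
open Summit.QuantumFields.YangMills.Theorems.GlobalSlack

/-! ## §1 Registered stubs (sorries live ONLY here) -/

/-- STUB 1 (statement v5h/v5j‴/v5k verbatim; CLOSED in the tree by name — p490827 `Theorems.ApproxLift.AnsatzT.stub_oneStepSmallLift`). [cite: Balaban1987RG1, (0.4) p.253, p.254 (small-field regions, Ū = V) and (0.16) p.255] -/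
theorem stub_oneStepSmallLift :
    ∀ L : ℕ, ∃ κ δ₀ : ℝ, κ * Real.sqrt L ≤ 1 ∧ 0 < δ₀ ∧
      ∀ F : T3Family, F.L = L → OneStepSmallLift F ℰp κ δ₀ := by
  sorry

/-- STUB 2′χ — the re-typed (α) record with print's lower row (R-57χ): `AlphaInputsT3ACv3RecChi L` by name. [cite: Balaban1985UV3, Thm 1 p.257, (7) p.257, (47) p.267, (55) p.269 and Thm 2 p.272] -/
theorem stub_laneRecordsV3Chi : ∀ L : ℕ, Odd L → 1 < L → Summit.QuantumFields.YangMills.Theorems.AlphaInputsT3ACv3RecChi L := by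
  sorry

/-- STUB 3⁗χ — v5k's 3⁗ over the χ-package family and its datum `dataOfV3chi`. [cite: King1986, Thm 3.4 (3.9) p.656; Balaban1985UV3, (43)-(46) pp.266-267 and (57) p.270] -/
theorem stub_globalTwoRunSlackFamChi :
    ∀ (L : ℕ), Odd L → 7 ≤ L → ∀ (𝔠 : Summit.QuantumFields.Balaban3D.Proofs.Primitives.AlphaConsts L (Summit.QuantumFields.Balaban3D.Carriers.suGroupModel 2).N)
      (a₀ a₁ : ℝ), 0 < a₀ → 0 < a₁ → 𝔠.B₃ * a₁ ≤ a₀ →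
      ∃ a : ℝ, 0 < a ∧ ∃ γB : ℝ, 0 < γB ∧ ∀ (F : T3Family) (γ : ℝ) (hF : F.L = L) (hγ : 0 < γ), γ ≤ γB →
        ∀ (hγ1 : γ ≤ (min (hF ▸ 𝔠).gamma0 1) ^ 2),
          Summit.QuantumFields.YangMills.Theorems.AlphaInputsT3AC.OfV3ChiAt F (hF ▸ 𝔠) a₀ a₁ →
          ∃ (p : ∀ K, Summit.QuantumFields.YangMills.Theorems.AlphaInputsT3AC.PkgAtV3Chi F (hF ▸ 𝔠) γ hγ hγ1 K),
            (∀ K, (p K).a₀ = a₀ ∧ (p K).a₁ = a₁) ∧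
            ∃ (π : Summit.QuantumFields.YangMills.Theorems.AlphaInputsT3AC.PolymerT3 F) (σ : ℕ) (C : ℝ), 7 ≤ σ ∧ 0 ≤ C ∧
              Summit.QuantumFields.YangMills.Theorems.GlobalSlack.GlobalSupRateTSlack (Summit.QuantumFields.YangMills.Theorems.AlphaInputsT3AC.dataOfV3chi p π) (hF ▸ 𝔠).b₀ (hF ▸ 𝔠).p₀ a σ C := by
  sorry

/-- STUB (i*)χ — v5k's (i*) over the χ-package family and its datum `dataOfV3chi`. [cite: King1986, Thm 3.4 (3.9) p.656] -/
theorem stub_smallBlocksSlackOnChiAllChi :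
    ∀ (L : ℕ), Odd L → 1 < L → L < 7 → ∀ (μ : ℝ), 0 < μ → μ < 1 →
      ∀ (𝔠 : Summit.QuantumFields.Balaban3D.Proofs.Primitives.AlphaConsts L (Summit.QuantumFields.Balaban3D.Carriers.suGroupModel 2).N)
        (a₀ a₁ : ℝ), 0 < a₀ → 0 < a₁ → 𝔠.B₃ * a₁ ≤ a₀ →
        ∃ a : ℝ, 0 < a ∧ ∃ γB : ℝ, 0 < γB ∧ ∀ (F : T3Family) (γ : ℝ) (hF : F.L = L) (hγ : 0 < γ), γ ≤ γB →
          ∀ (hγ1 : γ ≤ (min (hF ▸ 𝔠).gamma0 1) ^ 2),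
            Summit.QuantumFields.YangMills.Theorems.AlphaInputsT3AC.OfV3ChiAt F (hF ▸ 𝔠) a₀ a₁ →
            ∃ (p : ∀ K, Summit.QuantumFields.YangMills.Theorems.AlphaInputsT3AC.PkgAtV3Chi F (hF ▸ 𝔠) γ hγ hγ1 K),
              (∀ K, (p K).a₀ = a₀ ∧ (p K).a₁ = a₁) ∧
              ∃ (π : Summit.QuantumFields.YangMills.Theorems.AlphaInputsT3AC.PolymerT3 F) (σ : ℕ) (C : ℝ), 7 ≤ σ ∧ 0 ≤ C ∧
                ∀ ε₀ : ℝ, 0 < ε₀ → ε₀ ≤ a₀ →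
                  GlobalSupRateTSlackOn (fun K n h V => ChiGood F γ (hF ▸ 𝔠).b₀ (hF ▸ 𝔠).p₀ ε₀ μ (n := n) (K := K) h V)
                    (Summit.QuantumFields.YangMills.Theorems.AlphaInputsT3AC.dataOfV3chi p π) (hF ▸ 𝔠).b₀ (hF ▸ 𝔠).p₀ a σ C := by
  sorry

/-- STUB T8 (OWNER RULING g23-№2 ADD. 7) — [Balaban1985Variational] Thm 1 (global reading) ∧ its (8)-clause for EVERY minimiser, at every odd block size; closes BY NAME from
19200's `variational_of_leaves_log` via `InteriorExcision.thm1In8_of_attained_of_in8`. [cite: Balaban1985Variational, Thm 1 (8) p.279, Prop 7 p.299 and Prop 8 p.304] -/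
theorem stub_thm1In8GlobalMin : ∀ L : ℕ, Odd L → 1 < L → ∃ a₀ a₁ B₃ : ℝ, 0 < a₀ ∧ 0 < a₁ ∧ 0 < B₃ ∧
    Thm1GlobalMinAt L a₀ a₁ B₃ ∧ MinimisersIn8At L a₀ a₁ B₃ := by
  sorry

/-! ## §2 The composition — NO sorry below this line -/

/-- **`FluctuationComparisonRegPrIntL ⇐ STUB 1 ∧ T8 ∧ 2′χ ∧ 3⁗χ ∧ (i*)χ`** BY NAME through ★r1 g3's record-free engine at the χ-record (`InteriorExcision.regPrIntL_of_v3ChiStubs`;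
the Literature Prop and the route decl unfold to the same term). -/
theorem FluctuationComparisonRegPrIntL_of : Summit.QuantumFields.YangMills.Theses.UnitScaleTilt.FluctuationComparisonRegPrIntL :=
  Summit.QuantumFields.YangMills.Theorems.InteriorExcision.regPrIntL_of_v3ChiStubs stub_oneStepSmallLift stub_thm1In8GlobalMin
    stub_laneRecordsV3Chi stub_globalTwoRunSlackFamChi stub_smallBlocksSlackOnChiAllChi

end Summit.QuantumFields.YangMills.Cruxes.FluctuationComparisonRegPrIntL.BirthV5kC

end
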